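import Summits.NavierStokesRegularity.TurbBounds.Results.C200
import Summits.NavierStokesRegularity.TurbBounds.CouettePolyBridge
import Summits.NavierStokesRegularity.TurbBounds.Certs.C200.ModeForm1
import Summits.NavierStokesRegularity.TurbBounds.Certs.C200.ModeForm2
import Summits.NavierStokesRegularity.TurbBounds.Certs.C200.ModeForm3
import Summits.NavierStokesRegularity.TurbBounds.Certs.C200.ModeForm4
import Summits.NavierStokesRegularity.TurbBounds.Certs.C200.ModeForm5
import Summits.NavierStokesRegularity.TurbBounds.Certs.C200.ModeForm6
import Summits.NavierStokesRegularity.TurbBounds.Certs.C200.ModeForm7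
import Summits.NavierStokesRegularity.TurbBounds.Certs.C200.ModeForm8
import HarnessLib

/-!
# Row R-C200 (G1): polynomial positivity of the certified wavenumbers 1–8
(cell `pub-turb` / `turb-bounds`, shear lane; v2, written by pub-turb-shear gen 7, 2026-08-22 (generator lean-t12/frame/twins/gen_c200.py). Lands after
`CouetteForm`, `Results/C200`, `CouettePolyBridge` and the Ca items `Certs/C200/ModeForm1…22` (gen 6).)

HONEST FRAMING: rigorous bounds for the stated PDE and boundary conditions; no claim about physical turbulence beyond the bound.
Row R-C200 (gate G1, plane Couette Re 200, '2.5-D'): per certified spanwise wavenumber `k = 1 … 8` (`P = 12`) the two-field bridge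
`CouettePolyBridge.rbForm_poly_decomp` + `tailXTF_bound` feed `Certs.C200.ModeForm.M<k>.modeForm_nonneg`: `rbForm c c g k² ≥ 0` on two-sided polynomial pairs (part A of three).
-/

set_option linter.style.longLine false

noncomputable section

namespace Summit.NavierStokesRegularity.TurbBounds.Results.C200

open Polynomial intervalIntegral MeasureTheory Set Finset Literature.Analysis.SpecialFunctions
open Summit.NavierStokesRegularity.TurbBounds.LadderTail (w w_pos IsLadder)
open Summit.NavierStokesRegularity.TurbBounds.LegendreCoeffs
open Summit.NavierStokesRegularity.TurbBounds.TailPolyGenW (rbForm)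
open Summit.NavierStokesRegularity.TurbBounds.TailTwoSided (TwoSidedX legCoeff_farWall_W legCoeff_farWall_Θ)
open Summit.NavierStokesRegularity.TurbBounds.CouetteForm
open Summit.NavierStokesRegularity.TurbBounds.CouettePolyBridge
open Summit.NavierStokesRegularity.TurbBounds.ShearPolyBridge (gpOf)
open Summit.NavierStokesRegularity.TurbBounds.ShearSpecPieces
open Summit.NavierStokesRegularity.TurbBounds.ShearSpecPiecesTF
open Summit.NavierStokesRegularity.TurbBounds.Certs.C200

/-- **Wavenumber k = 1 of R-C200 (`N = 8`, `P = 12`) on two-sided polynomial pairs.** -/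
theorem polyPositivity_mode1 (Wp Θp : ℝ[X]) (hW0 : Wp.eval (-1) = 0) (hW1 : (derivative Wp).eval (-1) = 0) (hW2 : Wp.eval 1 = 0)
    (hW3 : (derivative Wp).eval 1 = 0) (hΘ0 : Θp.eval (-1) = 0) (hΘ1 : Θp.eval 1 = 0) :
    0 ≤ rbForm (Scalars.c : ℝ) (Scalars.c : ℝ) (fun x => gC200.eval x) (((1 : ℕ) : ℝ) ^ 2) (fun x => Wp.eval x) (fun x => Θp.eval x) := by
  set L := max (max Wp.natDegree Θp.natDegree) 12 + 1 with hL
  have hLW : Wp.natDegree < L := by omega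
  have hLΘ : Θp.natDegree < L := by omega
  have hPL : 12 ≤ L := by omega
  have hghat : ∀ p, p < 12 + 1 → ModeForm.M1.ghat p = ghatC200 p := by
    intro p hp; unfold ModeForm.M1.ghat ghatC200; interval_cases p <;> rfl
  have hg : gC200 = gpOf 12 ModeForm.M1.ghat := by
    unfold gC200 gpOf; exact sum_congr rfl fun p hp => by rw [hghat p (mem_range.mp hp)]
  have hK : (((1 : ℕ) : ℝ) ^ 2) ≠ 0 := by positivity
  have hKinv : (((1 / 1 : ℚ)) : ℝ) = 1 / (((1 : ℕ) : ℝ) ^ 2) := by norm_num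
  have hK2 : (((1 : ℚ)) : ℝ) = (((1 : ℕ) : ℝ) ^ 2) := by norm_num
  rw [hg, rbForm_poly_decomp 8 12 Scalars.c (1 / 1) 1 hK hKinv hK2 ModeForm.M1.ghat Wp Θp hW0 hW1 hΘ0 L hLW hLΘ]
  obtain ⟨hc0, hc1⟩ := legCoeff_farWall_W Wp hW0 hW1 hW2 hW3
  have hd0 := legCoeff_farWall_Θ Θp hΘ0 hΘ1
  have hA : IsLadder (legCoeff (derivative (derivative Wp))) (legCoeff (derivative Wp)) := isLadder_legCoeff (derivative Wp) hW1
  have h0a := legCoeff_zero_of_wall (derivative Wp) hW1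
  have hB : IsLadder (legCoeff (derivative Wp)) (legCoeff Wp) := isLadder_legCoeff Wp hW0
  have h0b := legCoeff_zero_of_wall Wp hW0
  have hE : IsLadder (legCoeff (derivative Θp)) (legCoeff Θp) := isLadder_legCoeff Θp hΘ0
  have h0e := legCoeff_zero_of_wall Θp hΘ0
  have hT : ∀ x ∈ Icc (-1 : ℝ) 1, |(gpOf 12 ModeForm.M1.ghat).eval x| ≤ (Scalars.T : ℝ) := by
    rw [← hg]; exact gC200_abs_le
  have heps : (0 : ℝ) < ((Scalars.eps.getD 0 0 : ℚ) : ℝ) := by norm_num [Scalars.eps]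
  have hX := tailXTF_bound 8 12 ModeForm.M1.ghat Wp Θp hT L hLW hLΘ heps
  exact ModeForm.M1.modeForm_nonneg hA h0a hB h0b hc0 hc1 hE h0e hd0 L hPL hX

/-- **Wavenumber k = 2 of R-C200 (`N = 16`, `P = 12`) on two-sided polynomial pairs.** -/
theorem polyPositivity_mode2 (Wp Θp : ℝ[X]) (hW0 : Wp.eval (-1) = 0) (hW1 : (derivative Wp).eval (-1) = 0) (hW2 : Wp.eval 1 = 0)
    (hW3 : (derivative Wp).eval 1 = 0) (hΘ0 : Θp.eval (-1) = 0) (hΘ1 : Θp.eval 1 = 0) :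
    0 ≤ rbForm (Scalars.c : ℝ) (Scalars.c : ℝ) (fun x => gC200.eval x) (((2 : ℕ) : ℝ) ^ 2) (fun x => Wp.eval x) (fun x => Θp.eval x) := by
  set L := max (max Wp.natDegree Θp.natDegree) 12 + 1 with hL
  have hLW : Wp.natDegree < L := by omega
  have hLΘ : Θp.natDegree < L := by omega
  have hPL : 12 ≤ L := by omega
  have hghat : ∀ p, p < 12 + 1 → ModeForm.M2.ghat p = ghatC200 p := by
    intro p hp; unfold ModeForm.M2.ghat ghatC200; interval_cases p <;> rfl
  have hg : gC200 = gpOf 12 ModeForm.M2.ghat := by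
    unfold gC200 gpOf; exact sum_congr rfl fun p hp => by rw [hghat p (mem_range.mp hp)]
  have hK : (((2 : ℕ) : ℝ) ^ 2) ≠ 0 := by positivity
  have hKinv : (((1 / 4 : ℚ)) : ℝ) = 1 / (((2 : ℕ) : ℝ) ^ 2) := by norm_num
  have hK2 : (((4 : ℚ)) : ℝ) = (((2 : ℕ) : ℝ) ^ 2) := by norm_num
  rw [hg, rbForm_poly_decomp 16 12 Scalars.c (1 / 4) 4 hK hKinv hK2 ModeForm.M2.ghat Wp Θp hW0 hW1 hΘ0 L hLW hLΘ]
  obtain ⟨hc0, hc1⟩ := legCoeff_farWall_W Wp hW0 hW1 hW2 hW3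
  have hd0 := legCoeff_farWall_Θ Θp hΘ0 hΘ1
  have hA : IsLadder (legCoeff (derivative (derivative Wp))) (legCoeff (derivative Wp)) := isLadder_legCoeff (derivative Wp) hW1
  have h0a := legCoeff_zero_of_wall (derivative Wp) hW1
  have hB : IsLadder (legCoeff (derivative Wp)) (legCoeff Wp) := isLadder_legCoeff Wp hW0
  have h0b := legCoeff_zero_of_wall Wp hW0
  have hE : IsLadder (legCoeff (derivative Θp)) (legCoeff Θp) := isLadder_legCoeff Θp hΘ0
  have h0e := legCoeff_zero_of_wall Θp hΘ0
  have hT : ∀ x ∈ Icc (-1 : ℝ) 1, |(gpOf 12 ModeForm.M2.ghat).eval x| ≤ (Scalars.T : ℝ) := by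
    rw [← hg]; exact gC200_abs_le
  have heps : (0 : ℝ) < ((Scalars.eps.getD 1 0 : ℚ) : ℝ) := by norm_num [Scalars.eps]
  have hX := tailXTF_bound 16 12 ModeForm.M2.ghat Wp Θp hT L hLW hLΘ heps
  exact ModeForm.M2.modeForm_nonneg hA h0a hB h0b hc0 hc1 hE h0e hd0 L hPL hX

/-- **Wavenumber k = 3 of R-C200 (`N = 16`, `P = 12`) on two-sided polynomial pairs.** -/
theorem polyPositivity_mode3 (Wp Θp : ℝ[X]) (hW0 : Wp.eval (-1) = 0) (hW1 : (derivative Wp).eval (-1) = 0) (hW2 : Wp.eval 1 = 0)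
    (hW3 : (derivative Wp).eval 1 = 0) (hΘ0 : Θp.eval (-1) = 0) (hΘ1 : Θp.eval 1 = 0) :
    0 ≤ rbForm (Scalars.c : ℝ) (Scalars.c : ℝ) (fun x => gC200.eval x) (((3 : ℕ) : ℝ) ^ 2) (fun x => Wp.eval x) (fun x => Θp.eval x) := by
  set L := max (max Wp.natDegree Θp.natDegree) 12 + 1 with hL
  have hLW : Wp.natDegree < L := by omega
  have hLΘ : Θp.natDegree < L := by omega
  have hPL : 12 ≤ L := by omega
  have hghat : ∀ p, p < 12 + 1 → ModeForm.M3.ghat p = ghatC200 p := by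
    intro p hp; unfold ModeForm.M3.ghat ghatC200; interval_cases p <;> rfl
  have hg : gC200 = gpOf 12 ModeForm.M3.ghat := by
    unfold gC200 gpOf; exact sum_congr rfl fun p hp => by rw [hghat p (mem_range.mp hp)]
  have hK : (((3 : ℕ) : ℝ) ^ 2) ≠ 0 := by positivity
  have hKinv : (((1 / 9 : ℚ)) : ℝ) = 1 / (((3 : ℕ) : ℝ) ^ 2) := by norm_num
  have hK2 : (((9 : ℚ)) : ℝ) = (((3 : ℕ) : ℝ) ^ 2) := by norm_num
  rw [hg, rbForm_poly_decomp 16 12 Scalars.c (1 / 9) 9 hK hKinv hK2 ModeForm.M3.ghat Wp Θp hW0 hW1 hΘ0 L hLW hLΘ]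
  obtain ⟨hc0, hc1⟩ := legCoeff_farWall_W Wp hW0 hW1 hW2 hW3
  have hd0 := legCoeff_farWall_Θ Θp hΘ0 hΘ1
  have hA : IsLadder (legCoeff (derivative (derivative Wp))) (legCoeff (derivative Wp)) := isLadder_legCoeff (derivative Wp) hW1
  have h0a := legCoeff_zero_of_wall (derivative Wp) hW1
  have hB : IsLadder (legCoeff (derivative Wp)) (legCoeff Wp) := isLadder_legCoeff Wp hW0
  have h0b := legCoeff_zero_of_wall Wp hW0
  have hE : IsLadder (legCoeff (derivative Θp)) (legCoeff Θp) := isLadder_legCoeff Θp hΘ0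
  have h0e := legCoeff_zero_of_wall Θp hΘ0
  have hT : ∀ x ∈ Icc (-1 : ℝ) 1, |(gpOf 12 ModeForm.M3.ghat).eval x| ≤ (Scalars.T : ℝ) := by
    rw [← hg]; exact gC200_abs_le
  have heps : (0 : ℝ) < ((Scalars.eps.getD 2 0 : ℚ) : ℝ) := by norm_num [Scalars.eps]
  have hX := tailXTF_bound 16 12 ModeForm.M3.ghat Wp Θp hT L hLW hLΘ heps
  exact ModeForm.M3.modeForm_nonneg hA h0a hB h0b hc0 hc1 hE h0e hd0 L hPL hX

/-- **Wavenumber k = 4 of R-C200 (`N = 16`, `P = 12`) on two-sided polynomial pairs.** -/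
theorem polyPositivity_mode4 (Wp Θp : ℝ[X]) (hW0 : Wp.eval (-1) = 0) (hW1 : (derivative Wp).eval (-1) = 0) (hW2 : Wp.eval 1 = 0)
    (hW3 : (derivative Wp).eval 1 = 0) (hΘ0 : Θp.eval (-1) = 0) (hΘ1 : Θp.eval 1 = 0) :
    0 ≤ rbForm (Scalars.c : ℝ) (Scalars.c : ℝ) (fun x => gC200.eval x) (((4 : ℕ) : ℝ) ^ 2) (fun x => Wp.eval x) (fun x => Θp.eval x) := by
  set L := max (max Wp.natDegree Θp.natDegree) 12 + 1 with hL
  have hLW : Wp.natDegree < L := by omega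
  have hLΘ : Θp.natDegree < L := by omega
  have hPL : 12 ≤ L := by omega
  have hghat : ∀ p, p < 12 + 1 → ModeForm.M4.ghat p = ghatC200 p := by
    intro p hp; unfold ModeForm.M4.ghat ghatC200; interval_cases p <;> rfl
  have hg : gC200 = gpOf 12 ModeForm.M4.ghat := by
    unfold gC200 gpOf; exact sum_congr rfl fun p hp => by rw [hghat p (mem_range.mp hp)]
  have hK : (((4 : ℕ) : ℝ) ^ 2) ≠ 0 := by positivity
  have hKinv : (((1 / 16 : ℚ)) : ℝ) = 1 / (((4 : ℕ) : ℝ) ^ 2) := by norm_num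
  have hK2 : (((16 : ℚ)) : ℝ) = (((4 : ℕ) : ℝ) ^ 2) := by norm_num
  rw [hg, rbForm_poly_decomp 16 12 Scalars.c (1 / 16) 16 hK hKinv hK2 ModeForm.M4.ghat Wp Θp hW0 hW1 hΘ0 L hLW hLΘ]
  obtain ⟨hc0, hc1⟩ := legCoeff_farWall_W Wp hW0 hW1 hW2 hW3
  have hd0 := legCoeff_farWall_Θ Θp hΘ0 hΘ1
  have hA : IsLadder (legCoeff (derivative (derivative Wp))) (legCoeff (derivative Wp)) := isLadder_legCoeff (derivative Wp) hW1
  have h0a := legCoeff_zero_of_wall (derivative Wp) hW1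
  have hB : IsLadder (legCoeff (derivative Wp)) (legCoeff Wp) := isLadder_legCoeff Wp hW0
  have h0b := legCoeff_zero_of_wall Wp hW0
  have hE : IsLadder (legCoeff (derivative Θp)) (legCoeff Θp) := isLadder_legCoeff Θp hΘ0
  have h0e := legCoeff_zero_of_wall Θp hΘ0
  have hT : ∀ x ∈ Icc (-1 : ℝ) 1, |(gpOf 12 ModeForm.M4.ghat).eval x| ≤ (Scalars.T : ℝ) := by
    rw [← hg]; exact gC200_abs_le
  have heps : (0 : ℝ) < ((Scalars.eps.getD 3 0 : ℚ) : ℝ) := by norm_num [Scalars.eps]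
  have hX := tailXTF_bound 16 12 ModeForm.M4.ghat Wp Θp hT L hLW hLΘ heps
  exact ModeForm.M4.modeForm_nonneg hA h0a hB h0b hc0 hc1 hE h0e hd0 L hPL hX

/-- **Wavenumber k = 5 of R-C200 (`N = 16`, `P = 12`) on two-sided polynomial pairs.** -/
theorem polyPositivity_mode5 (Wp Θp : ℝ[X]) (hW0 : Wp.eval (-1) = 0) (hW1 : (derivative Wp).eval (-1) = 0) (hW2 : Wp.eval 1 = 0)
    (hW3 : (derivative Wp).eval 1 = 0) (hΘ0 : Θp.eval (-1) = 0) (hΘ1 : Θp.eval 1 = 0) :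
    0 ≤ rbForm (Scalars.c : ℝ) (Scalars.c : ℝ) (fun x => gC200.eval x) (((5 : ℕ) : ℝ) ^ 2) (fun x => Wp.eval x) (fun x => Θp.eval x) := by
  set L := max (max Wp.natDegree Θp.natDegree) 12 + 1 with hL
  have hLW : Wp.natDegree < L := by omega
  have hLΘ : Θp.natDegree < L := by omega
  have hPL : 12 ≤ L := by omega
  have hghat : ∀ p, p < 12 + 1 → ModeForm.M5.ghat p = ghatC200 p := by
    intro p hp; unfold ModeForm.M5.ghat ghatC200; interval_cases p <;> rfl
  have hg : gC200 = gpOf 12 ModeForm.M5.ghat := by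
    unfold gC200 gpOf; exact sum_congr rfl fun p hp => by rw [hghat p (mem_range.mp hp)]
  have hK : (((5 : ℕ) : ℝ) ^ 2) ≠ 0 := by positivity
  have hKinv : (((1 / 25 : ℚ)) : ℝ) = 1 / (((5 : ℕ) : ℝ) ^ 2) := by norm_num
  have hK2 : (((25 : ℚ)) : ℝ) = (((5 : ℕ) : ℝ) ^ 2) := by norm_num
  rw [hg, rbForm_poly_decomp 16 12 Scalars.c (1 / 25) 25 hK hKinv hK2 ModeForm.M5.ghat Wp Θp hW0 hW1 hΘ0 L hLW hLΘ]
  obtain ⟨hc0, hc1⟩ := legCoeff_farWall_W Wp hW0 hW1 hW2 hW3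
  have hd0 := legCoeff_farWall_Θ Θp hΘ0 hΘ1
  have hA : IsLadder (legCoeff (derivative (derivative Wp))) (legCoeff (derivative Wp)) := isLadder_legCoeff (derivative Wp) hW1
  have h0a := legCoeff_zero_of_wall (derivative Wp) hW1
  have hB : IsLadder (legCoeff (derivative Wp)) (legCoeff Wp) := isLadder_legCoeff Wp hW0
  have h0b := legCoeff_zero_of_wall Wp hW0
  have hE : IsLadder (legCoeff (derivative Θp)) (legCoeff Θp) := isLadder_legCoeff Θp hΘ0
  have h0e := legCoeff_zero_of_wall Θp hΘ0
  have hT : ∀ x ∈ Icc (-1 : ℝ) 1, |(gpOf 12 ModeForm.M5.ghat).eval x| ≤ (Scalars.T : ℝ) := by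
    rw [← hg]; exact gC200_abs_le
  have heps : (0 : ℝ) < ((Scalars.eps.getD 4 0 : ℚ) : ℝ) := by norm_num [Scalars.eps]
  have hX := tailXTF_bound 16 12 ModeForm.M5.ghat Wp Θp hT L hLW hLΘ heps
  exact ModeForm.M5.modeForm_nonneg hA h0a hB h0b hc0 hc1 hE h0e hd0 L hPL hX

/-- **Wavenumber k = 6 of R-C200 (`N = 8`, `P = 12`) on two-sided polynomial pairs.** -/
theorem polyPositivity_mode6 (Wp Θp : ℝ[X]) (hW0 : Wp.eval (-1) = 0) (hW1 : (derivative Wp).eval (-1) = 0) (hW2 : Wp.eval 1 = 0)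
    (hW3 : (derivative Wp).eval 1 = 0) (hΘ0 : Θp.eval (-1) = 0) (hΘ1 : Θp.eval 1 = 0) :
    0 ≤ rbForm (Scalars.c : ℝ) (Scalars.c : ℝ) (fun x => gC200.eval x) (((6 : ℕ) : ℝ) ^ 2) (fun x => Wp.eval x) (fun x => Θp.eval x) := by
  set L := max (max Wp.natDegree Θp.natDegree) 12 + 1 with hL
  have hLW : Wp.natDegree < L := by omega
  have hLΘ : Θp.natDegree < L := by omega
  have hPL : 12 ≤ L := by omega
  have hghat : ∀ p, p < 12 + 1 → ModeForm.M6.ghat p = ghatC200 p := by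
    intro p hp; unfold ModeForm.M6.ghat ghatC200; interval_cases p <;> rfl
  have hg : gC200 = gpOf 12 ModeForm.M6.ghat := by
    unfold gC200 gpOf; exact sum_congr rfl fun p hp => by rw [hghat p (mem_range.mp hp)]
  have hK : (((6 : ℕ) : ℝ) ^ 2) ≠ 0 := by positivity
  have hKinv : (((1 / 36 : ℚ)) : ℝ) = 1 / (((6 : ℕ) : ℝ) ^ 2) := by norm_num
  have hK2 : (((36 : ℚ)) : ℝ) = (((6 : ℕ) : ℝ) ^ 2) := by norm_num
  rw [hg, rbForm_poly_decomp 8 12 Scalars.c (1 / 36) 36 hK hKinv hK2 ModeForm.M6.ghat Wp Θp hW0 hW1 hΘ0 L hLW hLΘ]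
  obtain ⟨hc0, hc1⟩ := legCoeff_farWall_W Wp hW0 hW1 hW2 hW3
  have hd0 := legCoeff_farWall_Θ Θp hΘ0 hΘ1
  have hA : IsLadder (legCoeff (derivative (derivative Wp))) (legCoeff (derivative Wp)) := isLadder_legCoeff (derivative Wp) hW1
  have h0a := legCoeff_zero_of_wall (derivative Wp) hW1
  have hB : IsLadder (legCoeff (derivative Wp)) (legCoeff Wp) := isLadder_legCoeff Wp hW0
  have h0b := legCoeff_zero_of_wall Wp hW0
  have hE : IsLadder (legCoeff (derivative Θp)) (legCoeff Θp) := isLadder_legCoeff Θp hΘ0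
  have h0e := legCoeff_zero_of_wall Θp hΘ0
  have hT : ∀ x ∈ Icc (-1 : ℝ) 1, |(gpOf 12 ModeForm.M6.ghat).eval x| ≤ (Scalars.T : ℝ) := by
    rw [← hg]; exact gC200_abs_le
  have heps : (0 : ℝ) < ((Scalars.eps.getD 5 0 : ℚ) : ℝ) := by norm_num [Scalars.eps]
  have hX := tailXTF_bound 8 12 ModeForm.M6.ghat Wp Θp hT L hLW hLΘ heps
  exact ModeForm.M6.modeForm_nonneg hA h0a hB h0b hc0 hc1 hE h0e hd0 L hPL hX

/-- **Wavenumber k = 7 of R-C200 (`N = 8`, `P = 12`) on two-sided polynomial pairs.** -/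
theorem polyPositivity_mode7 (Wp Θp : ℝ[X]) (hW0 : Wp.eval (-1) = 0) (hW1 : (derivative Wp).eval (-1) = 0) (hW2 : Wp.eval 1 = 0)
    (hW3 : (derivative Wp).eval 1 = 0) (hΘ0 : Θp.eval (-1) = 0) (hΘ1 : Θp.eval 1 = 0) :
    0 ≤ rbForm (Scalars.c : ℝ) (Scalars.c : ℝ) (fun x => gC200.eval x) (((7 : ℕ) : ℝ) ^ 2) (fun x => Wp.eval x) (fun x => Θp.eval x) := by
  set L := max (max Wp.natDegree Θp.natDegree) 12 + 1 with hL
  have hLW : Wp.natDegree < L := by omega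
  have hLΘ : Θp.natDegree < L := by omega
  have hPL : 12 ≤ L := by omega
  have hghat : ∀ p, p < 12 + 1 → ModeForm.M7.ghat p = ghatC200 p := by
    intro p hp; unfold ModeForm.M7.ghat ghatC200; interval_cases p <;> rfl
  have hg : gC200 = gpOf 12 ModeForm.M7.ghat := by
    unfold gC200 gpOf; exact sum_congr rfl fun p hp => by rw [hghat p (mem_range.mp hp)]
  have hK : (((7 : ℕ) : ℝ) ^ 2) ≠ 0 := by positivity
  have hKinv : (((1 / 49 : ℚ)) : ℝ) = 1 / (((7 : ℕ) : ℝ) ^ 2) := by norm_num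
  have hK2 : (((49 : ℚ)) : ℝ) = (((7 : ℕ) : ℝ) ^ 2) := by norm_num
  rw [hg, rbForm_poly_decomp 8 12 Scalars.c (1 / 49) 49 hK hKinv hK2 ModeForm.M7.ghat Wp Θp hW0 hW1 hΘ0 L hLW hLΘ]
  obtain ⟨hc0, hc1⟩ := legCoeff_farWall_W Wp hW0 hW1 hW2 hW3
  have hd0 := legCoeff_farWall_Θ Θp hΘ0 hΘ1
  have hA : IsLadder (legCoeff (derivative (derivative Wp))) (legCoeff (derivative Wp)) := isLadder_legCoeff (derivative Wp) hW1
  have h0a := legCoeff_zero_of_wall (derivative Wp) hW1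
  have hB : IsLadder (legCoeff (derivative Wp)) (legCoeff Wp) := isLadder_legCoeff Wp hW0
  have h0b := legCoeff_zero_of_wall Wp hW0
  have hE : IsLadder (legCoeff (derivative Θp)) (legCoeff Θp) := isLadder_legCoeff Θp hΘ0
  have h0e := legCoeff_zero_of_wall Θp hΘ0
  have hT : ∀ x ∈ Icc (-1 : ℝ) 1, |(gpOf 12 ModeForm.M7.ghat).eval x| ≤ (Scalars.T : ℝ) := by
    rw [← hg]; exact gC200_abs_le
  have heps : (0 : ℝ) < ((Scalars.eps.getD 6 0 : ℚ) : ℝ) := by norm_num [Scalars.eps]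
  have hX := tailXTF_bound 8 12 ModeForm.M7.ghat Wp Θp hT L hLW hLΘ heps
  exact ModeForm.M7.modeForm_nonneg hA h0a hB h0b hc0 hc1 hE h0e hd0 L hPL hX

/-- **Wavenumber k = 8 of R-C200 (`N = 8`, `P = 12`) on two-sided polynomial pairs.** -/
theorem polyPositivity_mode8 (Wp Θp : ℝ[X]) (hW0 : Wp.eval (-1) = 0) (hW1 : (derivative Wp).eval (-1) = 0) (hW2 : Wp.eval 1 = 0)
    (hW3 : (derivative Wp).eval 1 = 0) (hΘ0 : Θp.eval (-1) = 0) (hΘ1 : Θp.eval 1 = 0) :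
    0 ≤ rbForm (Scalars.c : ℝ) (Scalars.c : ℝ) (fun x => gC200.eval x) (((8 : ℕ) : ℝ) ^ 2) (fun x => Wp.eval x) (fun x => Θp.eval x) := by
  set L := max (max Wp.natDegree Θp.natDegree) 12 + 1 with hL
  have hLW : Wp.natDegree < L := by omega
  have hLΘ : Θp.natDegree < L := by omega
  have hPL : 12 ≤ L := by omega
  have hghat : ∀ p, p < 12 + 1 → ModeForm.M8.ghat p = ghatC200 p := by
    intro p hp; unfold ModeForm.M8.ghat ghatC200; interval_cases p <;> rfl
  have hg : gC200 = gpOf 12 ModeForm.M8.ghat := by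
    unfold gC200 gpOf; exact sum_congr rfl fun p hp => by rw [hghat p (mem_range.mp hp)]
  have hK : (((8 : ℕ) : ℝ) ^ 2) ≠ 0 := by positivity
  have hKinv : (((1 / 64 : ℚ)) : ℝ) = 1 / (((8 : ℕ) : ℝ) ^ 2) := by norm_num
  have hK2 : (((64 : ℚ)) : ℝ) = (((8 : ℕ) : ℝ) ^ 2) := by norm_num
  rw [hg, rbForm_poly_decomp 8 12 Scalars.c (1 / 64) 64 hK hKinv hK2 ModeForm.M8.ghat Wp Θp hW0 hW1 hΘ0 L hLW hLΘ]
  obtain ⟨hc0, hc1⟩ := legCoeff_farWall_W Wp hW0 hW1 hW2 hW3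
  have hd0 := legCoeff_farWall_Θ Θp hΘ0 hΘ1
  have hA : IsLadder (legCoeff (derivative (derivative Wp))) (legCoeff (derivative Wp)) := isLadder_legCoeff (derivative Wp) hW1
  have h0a := legCoeff_zero_of_wall (derivative Wp) hW1
  have hB : IsLadder (legCoeff (derivative Wp)) (legCoeff Wp) := isLadder_legCoeff Wp hW0
  have h0b := legCoeff_zero_of_wall Wp hW0
  have hE : IsLadder (legCoeff (derivative Θp)) (legCoeff Θp) := isLadder_legCoeff Θp hΘ0
  have h0e := legCoeff_zero_of_wall Θp hΘ0
  have hT : ∀ x ∈ Icc (-1 : ℝ) 1, |(gpOf 12 ModeForm.M8.ghat).eval x| ≤ (Scalars.T : ℝ) := by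
    rw [← hg]; exact gC200_abs_le
  have heps : (0 : ℝ) < ((Scalars.eps.getD 7 0 : ℚ) : ℝ) := by norm_num [Scalars.eps]
  have hX := tailXTF_bound 8 12 ModeForm.M8.ghat Wp Θp hT L hLW hLΘ heps
  exact ModeForm.M8.modeForm_nonneg hA h0a hB h0b hc0 hc1 hE h0e hd0 L hPL hX

end Summit.NavierStokesRegularity.TurbBounds.Results.C200

end
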